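import Summits.Ventures.HodgeRepro2.T5SU11KernelResolventIdentity
import Summits.Ventures.HodgeRepro2.T5SU11RadialGreenImproperOrigin

/-!
# The Green's kernel as a source: the difference quotient of two kernels is the resolvent of a kernel, and is
twice differentiable across the diagonal

For `λ, λ₂ > 1` and `s > 0`, the function `g_s(r) = K_{λ₂}(r, s) = −φ_{λ₂}(min(r,s)) χ_{λ₂}(max(r,s))` (row 461) is a
source of the exponentially decaying class (`kernel_source_continuousOn`, `kernel_source_bounded`,
`kernel_source_decay`: continuous on `(0, ∞)`, bounded on `(0, 1]`, `|g_s(r)| ≤ C e^{−λ₂ r}` beyond `max(s, T₀)`), so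
the improper Green's operator of row 492 applies to it, and by the kernel resolvent identity of row 511

**`G^I_λ(K_{λ₂}(·, s))(t) = (K_λ(t, s) − K_{λ₂}(t, s))/(μ − μ₂)`** for `λ ≠ λ₂` (`greenSolI_kernel_eq`).

Consequently the difference quotient of the two kernels inherits the regularity of `G^I_λ g_s` (rows 492, 497):
it is differentiable on `(0, ∞)` INCLUDING THE DIAGONAL `t = s` where each kernel alone has a corner
(`hasDerivAt_kernel_diff`, `hasDerivAt_kernel_diff'`), and solves the inhomogeneous radial equation with the
kernel as source, `(L − μ) u = K_{λ₂}(·, s)` (`kernel_diff_ode`) — the singularity of the Green's kernel on the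
diagonal (the jump `1/sinh 2s` of the derivative, row 461) is independent of the spectral parameter. Nothing is
claimed about (N).

Blind lane: Mathlib + the HodgeRepro2 prefix only; no sorry; axioms ⊆ {propext, Classical.choice,
Quot.sound}.
-/

namespace Summit.Ventures.HodgeRepro2.T5SU11KernelDifferenceRegularity

open Filter Topology MeasureTheory
open Set (Ioi Ioc Icc)
open T5SU11Cartan T5SU11SphericalFunction T5SU11SphericalBounds T5SU11SphericalContinuous
  T5SU11SphericalSolutionSpaceAll T5SU11SphericalAsymptotic T5SU11SphericalCfun T5SU11SphericalDecay
  T5SU11SphericalDecayBracket T5SU11RadialGreenKernel T5SU11RadialGreenImproper T5SU11RadialGreenImproperOrigin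
  T5SU11RadialGreenImproperDecaySource T5SU11ResolventCommute T5SU11ResolventKernelComposition
  T5SU11KernelResolventIdentity

section measure

variable [MeasurableSpace Circle] [BorelSpace Circle]

variable {lam lam₂ : ℝ} (hlam : 1 < lam) (hlam₂ : 1 < lam₂) {s : ℝ} (hs : 0 < s)

include hlam₂ hs in
/-- `r ↦ K_{λ₂}(r, s)` is continuous on `(0, ∞)`. -/
theorem kernel_source_continuousOn : ContinuousOn (fun r => sphGreenKernel lam₂ r s) (Ioi 0) := by
  have h := continuousOn_sphGreenKernel hlam₂ hs
  refine h.congr fun r _ => ?_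
  exact sphGreenKernel_symm lam₂ r s

include hlam₂ hs in
/-- `r ↦ K_{λ₂}(r, s)` is bounded on `(0, 1]`. -/
theorem kernel_source_bounded : ∃ M : ℝ, 0 ≤ M ∧ ∀ r ∈ Ioc (0 : ℝ) 1, |sphGreenKernel lam₂ r s| ≤ M := by
  obtain ⟨Φ, hΦ0, hΦ⟩ := exists_sph_hyp_le lam₂
  have hχ : ContinuousOn (sphDecay lam₂) (Ioi 0) :=
    fun _ hr => (hasDerivAt_sphDecay hlam₂ hr).continuousAt.continuousWithinAt
  -- `χ_{λ₂} ≤ X` on `[s, max 1 s]`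
  obtain ⟨r₀, hr₀, hmax⟩ := isCompact_Icc.exists_isMaxOn (Set.nonempty_Icc.mpr (le_max_right 1 s))
    (hχ.mono (fun r hr => lt_of_lt_of_le hs hr.1) : ContinuousOn (sphDecay lam₂) (Icc s (max 1 s)))
  set X := sphDecay lam₂ r₀ with hX
  have hX0 : 0 ≤ X := (sphDecay_pos hlam₂ (lt_of_lt_of_le hs hr₀.1)).le
  refine ⟨Φ * X, by positivity, fun r hr => ?_⟩
  have hr0 : 0 < r := hr.1
  have hmax0 : 0 < max r s := lt_of_lt_of_le hr0 (le_max_left r s)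
  unfold sphGreenKernel greenKernel
  rw [abs_neg, abs_mul, abs_of_pos (sph_hyp_pos lam₂ _), abs_of_pos (sphDecay_pos hlam₂ hmax0)]
  have h1 : sph lam₂ (hyp (min r s)) ≤ Φ := hΦ _ ⟨le_min hr0.le hs.le, le_trans (min_le_left r s) hr.2⟩
  have h2 : sphDecay lam₂ (max r s) ≤ X := by
    apply (isMaxOn_iff.mp hmax)
    exact ⟨le_max_right r s, max_le (le_trans hr.2 (le_max_left 1 s)) (le_max_right 1 s)⟩
  exact mul_le_mul h1 h2 (sphDecay_pos hlam₂ (lt_of_lt_of_le hs (le_max_right r s))).le hΦ0.le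

include hlam₂ hs in
/-- `|K_{λ₂}(r, s)| ≤ C e^{−λ₂ r}` beyond `max(s, T₀)`: the kernel source decays at the rate `λ₂`. -/
theorem kernel_source_decay : ∃ C s₀ : ℝ, ∀ r, s₀ ≤ r →
    |sphGreenKernel lam₂ r s| ≤ C * Real.exp (-lam₂ * r) := by
  obtain ⟨T₀, hT₀⟩ := eventually_atTop.mp (eventually_sphDecay_le hlam₂)
  refine ⟨sph lam₂ (hyp s) * (2 * (1 / ((lam₂ - 1) * cfun (2 - lam₂)))), max T₀ s, fun r hr => ?_⟩
  have hrs : s ≤ r := le_trans (le_max_right _ _) hr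
  have hr0 : 0 < r := lt_of_lt_of_le hs hrs
  unfold sphGreenKernel
  rw [greenKernel_of_le _ _ hrs, abs_neg, abs_mul, abs_of_pos (sph_hyp_pos lam₂ s), abs_of_pos (sphDecay_pos hlam₂ hr0),
    mul_assoc]
  exact mul_le_mul_of_nonneg_left (hT₀ r (le_trans (le_max_left _ _) hr)) (sph_hyp_pos lam₂ s).le

include hlam hlam₂ hs in
/-- **The resolvent applied to the kernel**: `G^I_λ(K_{λ₂}(·, s))(t) = (K_λ(t, s) − K_{λ₂}(t, s))/(μ − μ₂)` for `λ ≠ λ₂`. -/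
theorem greenSolI_kernel_eq (hne : lam ≠ lam₂) {t : ℝ} (ht : 0 < t) :
    greenSolI (fun t => sph lam (hyp t)) (sphDecay lam) (fun r => sphGreenKernel lam₂ r s) t
      = (sphGreenKernel lam t s - sphGreenKernel lam₂ t s) / (lam * (lam - 2) - lam₂ * (lam₂ - 2)) := by
  obtain ⟨M, hM0, hM⟩ := kernel_source_bounded hlam₂ hs
  obtain ⟨C, s₀, hC⟩ := kernel_source_decay hlam₂ hs
  have hg := kernel_source_continuousOn hlam₂ hs
  have hB := integrableOn_sph_mul_mul_sinh_Ioc hg hM hM0 lam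
  have hA := integrableOn_sphDecay_mul_mul_sinh hlam hg hM hM0 (by linarith : 2 - lam < lam₂) hC
  rw [greenSolI_eq_integral_kernel hB hA ht, ← kernel_comp_eq hlam hlam₂ hne ht hs]
  rfl

include hlam hlam₂ hs in
/-- **The difference quotient of the kernels is differentiable on `(0, ∞)`, across the diagonal**, with the
derivative `−χ_λ′ B^I − φ_λ′ A^I` of row 492. -/
theorem hasDerivAt_kernel_diff (hne : lam ≠ lam₂) {t : ℝ} (ht : 0 < t) :
    HasDerivAt (fun t => (sphGreenKernel lam t s - sphGreenKernel lam₂ t s) / (lam * (lam - 2) - lam₂ * (lam₂ - 2)))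
      (greenSolI' (deriv fun t => sph lam (hyp t)) (sphDecay' lam) (fun t => sph lam (hyp t)) (sphDecay lam)
        (fun r => sphGreenKernel lam₂ r s) t) t := by
  obtain ⟨M, hM0, hM⟩ := kernel_source_bounded hlam₂ hs
  obtain ⟨C, s₀, hC⟩ := kernel_source_decay hlam₂ hs
  have hg := kernel_source_continuousOn hlam₂ hs
  have hB := integrableOn_sph_mul_mul_sinh_Ioc hg hM hM0 lam
  have hA := integrableOn_sphDecay_mul_mul_sinh hlam hg hM hM0 (by linarith : 2 - lam < lam₂) hC
  have h := hasDerivAt_greenSolI (hφ_sph lam) (fun _ hs => hasDerivAt_sphDecay hlam hs) hg hB hA ht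
  refine h.congr_of_eventuallyEq ?_
  filter_upwards [Ioi_mem_nhds ht] with t' ht'
  exact (greenSolI_kernel_eq hlam hlam₂ hs hne ht').symm

include hlam hlam₂ hs in
/-- The derivative of the difference quotient is again differentiable, with the second derivative of row 492. -/
theorem hasDerivAt_kernel_diff' {t : ℝ} (ht : 0 < t) :
    HasDerivAt (greenSolI' (deriv fun t => sph lam (hyp t)) (sphDecay' lam) (fun t => sph lam (hyp t)) (sphDecay lam)
        (fun r => sphGreenKernel lam₂ r s))
      (greenSolI'' (deriv (deriv fun t => sph lam (hyp t))) (sphDecay'' lam) (deriv fun t => sph lam (hyp t))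
        (sphDecay' lam) (fun t => sph lam (hyp t)) (sphDecay lam) (fun r => sphGreenKernel lam₂ r s) t) t := by
  obtain ⟨M, hM0, hM⟩ := kernel_source_bounded hlam₂ hs
  obtain ⟨C, s₀, hC⟩ := kernel_source_decay hlam₂ hs
  have hg := kernel_source_continuousOn hlam₂ hs
  have hB := integrableOn_sph_mul_mul_sinh_Ioc hg hM hM0 lam
  have hA := integrableOn_sphDecay_mul_mul_sinh hlam hg hM hM0 (by linarith : 2 - lam < lam₂) hC
  exact hasDerivAt_greenSolI' (hφ_sph lam) (hφ'_sph lam) (fun _ hs => hasDerivAt_sphDecay hlam hs)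
    (fun _ hs => hasDerivAt_sphDecay' lam hs) hg hB hA ht

include hlam hlam₂ hs in
/-- **The difference quotient of the kernels solves `(L − μ) u = K_{λ₂}(·, s)` on all of `(0, ∞)`** (in the
derivative data of rows 492): `sinh 2t u″ + 2 cosh 2t u′ = μ sinh 2t u + sinh 2t K_{λ₂}(t, s)`. -/
theorem kernel_diff_ode (hne : lam ≠ lam₂) {t : ℝ} (ht : 0 < t) :
    Real.sinh (2 * t) * greenSolI'' (deriv (deriv fun t => sph lam (hyp t))) (sphDecay'' lam)
        (deriv fun t => sph lam (hyp t)) (sphDecay' lam) (fun t => sph lam (hyp t)) (sphDecay lam)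
        (fun r => sphGreenKernel lam₂ r s) t
      + 2 * Real.cosh (2 * t) * greenSolI' (deriv fun t => sph lam (hyp t)) (sphDecay' lam)
        (fun t => sph lam (hyp t)) (sphDecay lam) (fun r => sphGreenKernel lam₂ r s) t
      = lam * (lam - 2) * Real.sinh (2 * t)
          * ((sphGreenKernel lam t s - sphGreenKernel lam₂ t s) / (lam * (lam - 2) - lam₂ * (lam₂ - 2)))
        + Real.sinh (2 * t) * sphGreenKernel lam₂ t s := by
  rw [← greenSolI_kernel_eq hlam hlam₂ hs hne ht]
  exact greenSolI_ode (hode_sph lam) (fun _ hs => sphDecay_ode hlam hs) (fun _ hs => wronskian_sphDecay hlam hs)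
    (g := fun r => sphGreenKernel lam₂ r s) ht

end measure

end Summit.Ventures.HodgeRepro2.T5SU11KernelDifferenceRegularity
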